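import Summits.BirchSwinnertonDyer.Rank1Residual.F1Sign2.MinusHalfSumPureCycleProofs
import Literature.NumberTheory.EllipticCurves.ModularFormsGamma0Genus
import Literature.NumberTheory.EllipticCurves.GrossZagierRationalPointPeriodProofs
import HarnessLib

/-!
# Cell `bsd-f1-sign2`, AN-33k/l/m PROOFS: the full twisted Birch sum mod `4u` and the non-vanishing of `L(f,χ,1)` / `L(W^{(d)},1)` at pure 3-cycle doors — KERNEL-CHECKED (-an g16, Sketch_v28 §8; TURNKEY D-an-77, step 5)

TYPER FILING (cell `bsd-f1-sign2`, seat `-ty` g11; = `MEMO-an-data/g16/turnkey/TwistedMinusSymbolSumProofs.lean` 31e50086ba273349, plan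
`turnkey/AN33k_PLAN.md` 7f0f7c3baffbdbe1 step 4): §8 of `MEMO-an-data/g16/Sketch_v28.lean` d50ca18231cd831c VERBATIM (-an: farm rc 0 · 0 err ·
0 warn · 0 sorry inside the sketch and inside the Literature-only standalone `g16/UnitDoorSymbolParityAtTwo_TURNKEY.lean` 70d0b681337b64d6),
in the namespace of the statement file `F1Sign2/MinusHalfSumParityAtTwo.lean` and importing the AN-33j proofs file
`F1Sign2/MinusHalfSumPureCycleProofs.lean` (uses `minusUnitHalfSumPureCycleLaw_holds`, `sum_weight_mul_ratMinusSymbol`, `exists_int_sum_sub_sum`).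
Contents: `sum_univ_zmod_eq_sum_range` (reindex `ZMod m` by `range m`), `ratMinusTwistedSymbolSum_eq_sum_Icc` (fold the full twisted sum onto the
half system with weights `c_k + c_{m−k}`, via `sum_weight_mul_ratMinusSymbol`), `ratMinusTwistedSymbolSum_eq_two_mul_unitsHalfSum` (for odd weights
`≡ 1` on units and `0` off units: `Σ = 2F×_m + 4zu`), `exists_intLift_of_quadratic` (an odd quadratic character has such an integer lift),
**`twistedMinusSymbolSumUnitClassLaw_holds : TwistedMinusSymbolSumUnitClassLaw`** (AN-33k), **`twistedLValue_one_ne_zero_of_pureCycle`** (AN-33l: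
`η_f = 1 ⟹ L(f, χ̄, 1) ≠ 0` for every odd quadratic primitive `χ` of pure 3-cycle conductor, by the tree's PROVED Birch formula
`ratMinusTwistedSymbolSum_mul_minusPeriod_mul_I` and `IsNewform0.minusPeriod_pos_holds`), **`entireLFunction_quadraticTwist_one_ne_zero_of_pureCycle`**
(AN-33m: for `W` with `IsNewformOf W f` and `hasEntireLFunction_rat`, `(W.quadraticTwist d).entireLFunction 1 ≠ 0` for every `d < 0`, `d ≡ 1 (4)`
square-free, `gcd(d, N_W) = 1`, all prime factors `q ∤ N` with `a_q` odd — via `ratMinusTwistedSymbolSum_jacobiChar_mul_minusPeriod`,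
`LFunction_quadraticTwist_apply_of_int_gcd_eq_one`, `isPrimitive_jacobiChar`, `jacobiChar_neg_one_of_mod_four_eq_three`, `isQuadratic_jacobiChar`).
Placement (REF2-PLACEMENT-v33 §1.3; -an presearch v1.31/v1.32): mechanism IN-PRINT-ASSEMBLY — Mazur–Tate 1987 §1, Cai–Li–Zhai 2020 Lemma 4.1,
Zhai 2021 Prop. 3.2–3.3, Zhai 2016 Thm 1.1 (proof), Adachi–Nomoto–Shii 2026 Thm 1.1 / (3) (Zhao's induction with unit sums; no equality case at
`L(f,1) = 0`, odd conductor there).  REF1 §123 (refuter-bsd-f1-sign2-ref1 g11, 2026-08-28T16:14:00Z; `REF1-AUDIT-v1.md` l.2413, `REF1-data/b123/`):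
«`#print axioms` standard for AN-33k/l/m AND their tree inputs (Birch odd/signed, Ω⁻ > 0, twist coefficients) — all three PROVED (kernel); modularity
enters AN-33m only as the explicit hypotheses `hasEntireLFunction_rat` + `IsNewformOf W f`; seed normalisation explicit (rider r1: u/2 is again a
unit and flips the seed parity ⇒ «η_f = 1» is a property of the pair (f,u)); BC7 falsifier kit j312128 on AN-33m's FULL reach (d < 0, d ≡ 1 (4),
(d,N) = 1, 3-cycle support, |d| ≤ 1 500): η = 1 curves 37a1…229a1 (12): 826/826 twists L(W^{(d)},1) ≠ 0 (min |L| 0.056); contrast η = 0: 359a1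
20/69, 359b1 27/69 vanish; 43a1/53a1/61a1 (Δ<0) 58/58, 75/75, 75/75 vanish (rank 1, odd sign forced) — consistent; KILLED none; nearest held print
for the METHOD: Cai–Li–Zhai 2019 Thm 1.1 (`T′_{d,m} = (a_q − 2χ_d(q))T′_{d,m/q}`) — regime differs (2-torsion, q ≡ 1 (4), positive twists).»
REF2-PLACEMENT v35 §1 (refuter-bsd-f1-sign2-ref2 g35, 2026-08-28T16:23:44Z; `HOME/REF2-PLACEMENT-v35.md` 2c54b4d948616f7a; D-an-78 ANSWERED),
REF2_TXT_AN33klm verbatim: «REF2 v35 §1: statement NOT IN PRINT — the door-seeded exact 2-adic class / non-vanishing for odd quadratic characters of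
odd pure-S₀ (3-cycle) conductor at Δ_E > 0 fills the cell Adachi–Nomoto–Shii 2026 Table 1 row (12) leaves empty (Rem. 4.5: «not determined only by
v₂(T₁) and v₂(a_q − 2)») and Zhai 2021 Rem. 1.4 declines; nearest print Kriz–Li 2019 Thm 3.3 / Ex. 6.1 (Heegner level, K-split sub-family), ANS
Thm 4.3–4.4 (T₄-seeded conductor-4m family, 37a1), Kriz–Nordentoft 2023 Cor. 5.18 (plus side, even characters, quantitative); mechanism = in-print
assembly (Mazur–Tate 1987 §1, Zhai 2016 L2.2, Cai–Li–Zhai 2020 L4.1, ANS §3); NEW-COMBINATION-small; kernel-checked; beyond-print theorem: no. BSD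
is not proved by this.»  (REF2 riders v35 §1.5, census asks to -an: r1 «v₂(T₄(f)) = 0 ⟺ η_f = 1», r2 KL Ex 6.1 signed primes ⊆ the 826/826 reach,
r3 root-number consistency law «η_f = 1 forces sign(Δ_E) = −w(E) and sqfree|Δ_E| = sqfree(N)».)  Bib keys: Zhai 2021 = arXiv:2102.11798, published
as `Zhai2025` (Pure Appl. Math. Q.); Cai–Li–Zhai 2020 = `CaiLiZhai2019` (JLMS 101).
[cite: AdachiNomotoShii2026, Thm. 4.1, Rem. 4.5, Table 1, Thm. 4.3–4.4] [cite: Zhai2025, Rem. 1.4] [cite: KrizLi2019, Thm. 3.3, Ex. 6.1]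
[cite: KrizNordentoft2023, Thm. 5.9, Cor. 5.18] [cite: Zhai2016, Lemma 2.2] [cite: CaiLiZhai2019, Lemma 4.1] [cite: MazurTate1987, §1]
PARTITION: none moved; beyond-print theorem: no (REF2 v35 §1: NEW-COMBINATION-small, statement not in print, mechanism in-print-assembly;
kernel-checked yes).
Typer edits = this header and the imports; proofs verbatim.  Nothing here proves BSD; 23715 not closed.
[cite: MazurTate1987, §1] [cite: CaiLiZhai2019, Lemma 4.1] [cite: AdachiNomotoShii2026, Thm 1.1]
-/

set_option autoImplicit false

noncomputable section

open scoped Classical MatrixGroups ModularForm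

open CongruenceSubgroup WeierstrassCurve Literature.NumberTheory.EllipticCurves Literature.NumberTheory.EllipticCurves.ModularForms

namespace Summit.BirchSwinnertonDyer.Rank1Residual.F1Sign2.ANg16

section TwistedSum

open Finset

variable {N : ℕ} [NeZero N] (f : CuspForm (Gamma0 N) 2)

/-- Reindex a sum over `ZMod m` by the representatives `0 ≤ k < m`. -/
theorem sum_univ_zmod_eq_sum_range {m : ℕ} [NeZero m] (g : ZMod m → ℂ) :
    ∑ a : ZMod m, g a = ∑ k ∈ range m, g (k : ZMod m) := by
  refine Finset.sum_nbij' (fun a : ZMod m => a.val) (fun k => (k : ZMod m)) ?_ ?_ ?_ ?_ ?_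
  · intro a _; exact mem_range.mpr (ZMod.val_lt a)
  · intro k _; exact mem_univ _
  · intro a _; exact ZMod.natCast_zmod_val a
  · intro k hk
    have hk' : k < m := by simpa using hk
    exact ZMod.val_natCast_of_lt hk'
  · intro a _; rw [ZMod.natCast_zmod_val]

omit [NeZero N] in
/-- The full twisted sum over `a mod m` as a sum over `1 ≤ n ≤ m − 1` with the integer lift `c` of `χ`. -/
theorem ratMinusTwistedSymbolSum_eq_sum_Icc (h : ℕ) {m : ℕ} [NeZero m] (hmh : m = 2 * h + 1)
    (χ : DirichletCharacter ℂ m) (c : ℕ → ℤ) (hc : ∀ k : ℕ, χ (k : ZMod m) = (c k : ℂ)) :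
    ratMinusTwistedSymbolSum f χ =
      ((∑ n ∈ Icc 1 (2 * h), (c n : ℚ) * ratMinusSymbol f ((n : ℚ) / ((2 * h + 1 : ℕ) : ℚ)) : ℚ) : ℂ) := by
  unfold ratMinusTwistedSymbolSum
  rw [sum_univ_zmod_eq_sum_range]
  have hterm : ∀ k ∈ range m, χ (k : ZMod m) * (ratMinusSymbol f ((((k : ZMod m).val : ℕ) : ℚ) / (m : ℚ)) : ℂ) =
      (((c k : ℚ) * ratMinusSymbol f ((k : ℚ) / ((2 * h + 1 : ℕ) : ℚ)) : ℚ) : ℂ) := by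
    intro k hk
    rw [mem_range] at hk
    rw [ZMod.val_natCast_of_lt hk, hc k, hmh]
    push_cast
    ring
  rw [sum_congr rfl hterm, ← Rat.cast_sum]
  congr 1
  -- `range m = {0} ∪ [1, 2h]`, the `k = 0` term vanishes (`[0]⁻ = 0`)
  rw [hmh, Finset.sum_range_succ', Nat.cast_zero, zero_div, ratMinusSymbol_zero, mul_zero, add_zero]
  have hI : Icc 1 (2 * h) = Ico 1 (2 * h + 1) := by
    ext n; simp only [mem_Icc, mem_Ico]; omega
  rw [hI, Finset.sum_Ico_eq_sum_range]
  refine sum_congr (by simp) fun k _ => ?_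
  rw [add_comm]

/-- **AN-33k (symbol half).**  For an odd `m = 2h+1`, a symbol unit `u`, an ODD Dirichlet character `χ mod m` with INTEGER values
(`χ(k) = c k`) that are ODD on the units `k ≤ h` (e.g. any odd quadratic character: `c k = ±1`):
`Σ_{a mod m} χ(a)[a/m]⁻_f = 2·F×_m + 4zu` for some `z ∈ ℤ`, where `F×_m = Σ_{k ≤ h, (k,m)=1} [k/m]⁻_f`. -/
theorem ratMinusTwistedSymbolSum_eq_two_mul_unitsHalfSum {u : ℚ} (hu : IsMinusSymbolUnit f u) (h : ℕ) {m : ℕ} [NeZero m]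
    (hmh : m = 2 * h + 1) (χ : DirichletCharacter ℂ m) (hχo : χ.Odd) (c : ℕ → ℤ) (hc : ∀ k : ℕ, χ (k : ZMod m) = (c k : ℂ))
    (hodd : ∀ k ∈ Icc 1 h, Nat.Coprime k m → Odd (c k)) :
    ∃ z : ℤ, ratMinusTwistedSymbolSum f χ = (((2 : ℚ) * minusHalfSumUnits f m + 4 * z * u : ℚ) : ℂ) := by
  -- (1) integer bookkeeping of `c`: `c (m - k) = - c k` (oddness) and `c k = 0` off the units
  have hrefl : ∀ k ∈ Icc 1 h, c (2 * h + 1 - k) = - c k := by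
    intro k hk
    rw [mem_Icc] at hk
    have h1 : (((2 * h + 1 - k : ℕ) : ZMod m)) = - (k : ZMod m) := by
      rw [Nat.cast_sub (by omega), ← hmh, ZMod.natCast_self, zero_sub]
    have h2 : χ (-(k : ZMod m)) = - χ (k : ZMod m) := by
      rw [neg_eq_neg_one_mul ((k : ZMod m)), map_mul, hχo]; ring
    have h3 : (c (2 * h + 1 - k) : ℂ) = ((-c k : ℤ) : ℂ) := by
      rw [← hc, h1, h2, hc]; push_cast; ring
    exact_mod_cast h3
  have hzero : ∀ k ∈ Icc 1 h, ¬ Nat.Coprime k m → c k = 0 := by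
    intro k hk hcop
    have hnu : ¬ IsUnit (k : ZMod m) := by rwa [ZMod.isUnit_iff_coprime]
    have h3 : (c k : ℂ) = ((0 : ℤ) : ℂ) := by rw [← hc, MulChar.map_nonunit χ hnu]; simp
    exact_mod_cast h3
  -- (2) the symbol sum in `ℚ`
  rw [ratMinusTwistedSymbolSum_eq_sum_Icc f h hmh χ c hc, sum_weight_mul_ratMinusSymbol]
  obtain ⟨hu0, hu⟩ := hu
  choose Z hZ using hu
  have hpt : ∀ k ∈ Icc 1 h,
      ∃ z : ℤ, ((c k - c (2 * h + 1 - k) : ℤ) : ℚ) * ratMinusSymbol f ((k : ℚ) / ((2 * h + 1 : ℕ) : ℚ)) -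
        2 * (if Nat.Coprime k m then ratMinusSymbol f ((k : ℚ) / ((2 * h + 1 : ℕ) : ℚ)) else 0) = 2 * z * (2 * u) := by
    intro k hk
    rw [hrefl k hk]
    by_cases hcop : Nat.Coprime k m
    · obtain ⟨w, hw⟩ := hodd k hk hcop
      rw [if_pos hcop, hZ, hw]
      exact ⟨w * Z _, by push_cast; ring⟩
    · rw [if_neg hcop, hzero k hk hcop]
      exact ⟨0, by push_cast; ring⟩
  obtain ⟨z, hz⟩ := exists_int_sum_sub_sum (Icc 1 h) _ _ hpt
  refine ⟨z, ?_⟩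
  have hF : minusHalfSumUnits f m = ∑ k ∈ Icc 1 h, (if Nat.Coprime k m then ratMinusSymbol f ((k : ℚ) / ((2 * h + 1 : ℕ) : ℚ)) else 0) := by
    unfold minusHalfSumUnits
    rw [Finset.sum_filter, hmh, show (2 * h + 1 - 1) / 2 = h from by omega]
  rw [← mul_sum] at hz
  congr 1
  rw [hF]
  linear_combination hz

end TwistedSum

section TwistedValue

open scoped NumberTheorySymbols

open Finset Literature.NumberTheory.QuadraticFields

variable {N : ℕ} [NeZero N] (f : CuspForm (Gamma0 N) 2)

/-- Integer lift of a quadratic character: `c k ∈ {0, ±1}` with `χ(k) = c k`. -/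
theorem exists_intLift_of_quadratic {m : ℕ} [NeZero m] (χ : DirichletCharacter ℂ m)
    (hq : ∀ x : (ZMod m)ˣ, χ x = 1 ∨ χ x = -1) :
    ∃ c : ℕ → ℤ, (∀ k : ℕ, χ (k : ZMod m) = (c k : ℂ)) ∧ (∀ k : ℕ, Nat.Coprime k m → Odd (c k)) := by
  classical
  let c : ℕ → ℤ := fun k => if χ (k : ZMod m) = 1 then 1 else if χ (k : ZMod m) = -1 then -1 else 0
  have hc_def : ∀ k, c k = if χ (k : ZMod m) = 1 then 1 else if χ (k : ZMod m) = -1 then -1 else 0 := fun k => rfl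
  have hne : (-1 : ℂ) ≠ 1 := by norm_num
  refine ⟨c, ?_, ?_⟩
  · intro k
    rw [hc_def]
    by_cases hku : IsUnit (k : ZMod m)
    · obtain ⟨x, hx⟩ := hku
      rcases hq x with h1 | h1
      · rw [hx] at h1
        rw [if_pos h1, h1]; simp
      · rw [hx] at h1
        have hne1 : χ (k : ZMod m) ≠ 1 := by rw [h1]; exact hne
        rw [if_neg hne1, if_pos h1, h1]; simp
    · have h0 : χ (k : ZMod m) = 0 := MulChar.map_nonunit χ hku
      have hne1 : χ (k : ZMod m) ≠ 1 := by rw [h0]; norm_num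
      have hne2 : χ (k : ZMod m) ≠ -1 := by rw [h0]; norm_num
      rw [if_neg hne1, if_neg hne2, h0]; simp
  · intro k hk
    have hku : IsUnit (k : ZMod m) := (ZMod.isUnit_iff_coprime k m).mpr hk
    obtain ⟨x, hx⟩ := hku
    rw [hc_def]
    rcases hq x with h1 | h1
    · rw [hx] at h1
      rw [if_pos h1]; exact odd_one
    · rw [hx] at h1
      have hne1 : χ (k : ZMod m) ≠ 1 := by rw [h1]; exact hne
      rw [if_neg hne1, if_pos h1]; exact odd_neg_one

/-- **AN-33k PROVED.** -/
theorem twistedMinusSymbolSumUnitClassLaw_holds : TwistedMinusSymbolSumUnitClassLaw := by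
  intro N _ f hf hQ u hu q₀ a₀ hq₀ hq₀o hq₀N ha₀ ha₀o a m _ hsq hmo hpr χ hχo hq
  obtain ⟨c, hc, hcodd⟩ := exists_intLift_of_quadratic χ hq
  obtain ⟨h, hmh⟩ := hmo
  have hmh' : m = 2 * h + 1 := by omega
  obtain ⟨z₁, hz₁⟩ := ratMinusTwistedSymbolSum_eq_two_mul_unitsHalfSum f hu h hmh' χ hχo c hc
    (fun k _ hk => hcodd k hk)
  have hj := minusUnitHalfSumPureCycleLaw_holds N f hf hQ u hu q₀ a₀ hq₀ hq₀o hq₀N ha₀ ha₀o a m hsq ⟨h, hmh⟩ hpr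
  refine ⟨fun hpure => ?_, fun hnp => ?_⟩
  · obtain ⟨z₂, hz₂⟩ := hj.1 hpure
    refine ⟨z₁ + z₂, ?_⟩
    rw [hz₁, hz₂]; push_cast; ring
  · obtain ⟨z₂, hz₂⟩ := hj.2 hnp
    refine ⟨z₁ + z₂, ?_⟩
    rw [hz₁, hz₂]; push_cast; ring

/-- **AN-33l: NON-VANISHING of `L(f, χ̄, 1)` on the whole pure-`3`-cycle family from one bit.**  If `η_f = 1`
(`F_{q₀} = (2z₀+1)u` at one — hence every — `3`-cycle prime `q₀ ∤ N`), then for every square-free odd `m > 1` coprime to `N`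
whose prime factors are all `3`-cycle primes (`a_q` odd) and every odd primitive quadratic character `χ mod m`, the entire
continuation `L` of `L(f, χ̄, s)` has `L(1) ≠ 0`.  (Birch: `Σ·Ω⁻·i = τ(χ)·L(1)` with `Σ ≡ 2u (mod 4u)`, `Ω⁻ > 0`.) -/
theorem twistedLValue_one_ne_zero_of_pureCycle (hf : IsNewform0 f) (hQ : coeffField f = ⊥) {u : ℚ} (hu : IsMinusSymbolUnit f u)
    {q₀ : ℕ} {a₀ : ℤ} (hq₀ : q₀.Prime) (hq₀o : Odd q₀) (hq₀N : ¬ q₀ ∣ N) (ha₀ : cuspCoeff f q₀ = (a₀ : ℂ)) (ha₀o : Odd a₀)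
    (hη : ∃ z₀ : ℤ, minusHalfSum f q₀ = (2 * z₀ + 1) * u)
    (a : ℕ → ℤ) {m : ℕ} [NeZero m] (hsq : Squarefree m) (hmo : Odd m) (hm1 : 1 < m)
    (hpr : ∀ q ∈ m.primeFactors, ¬ q ∣ N ∧ cuspCoeff f q = (a q : ℂ)) (hpure : ∀ q ∈ m.primeFactors, Odd (a q))
    {χ : DirichletCharacter ℂ m} (hχ : χ.IsPrimitive) (hχo : χ.Odd) (hq : ∀ x : (ZMod m)ˣ, χ x = 1 ∨ χ x = -1)
    {L : ℂ → ℂ} (hL : Differentiable ℂ L) (hL' : ∀ s : ℂ, 2 < s.re → L s = twistedLSeries f χ⁻¹ s) :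
    L 1 ≠ 0 := by
  obtain ⟨z, hz⟩ := (twistedMinusSymbolSumUnitClassLaw_holds N f hf hQ u hu q₀ a₀ hq₀ hq₀o hq₀N ha₀ ha₀o a m hsq hmo hpr
    χ hχo hq).1 ⟨hm1, hpure⟩
  obtain ⟨z₀, hz₀⟩ := hη
  have hB := ratMinusTwistedSymbolSum_mul_minusPeriod_mul_I f hf hQ hχ hχo hL hL'
  have hΩ : 0 < minusPeriod f := IsNewform0.minusPeriod_pos_holds hf hQ
  have hS : ratMinusTwistedSymbolSum f χ ≠ 0 := by
    rw [hz, hz₀]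
    have hq' : (2 : ℚ) * ((2 * z₀ + 1) * u) + 4 * z * u ≠ 0 := by
      have : (2 : ℚ) * ((2 * z₀ + 1) * u) + 4 * z * u = (4 * (z₀ + z) + 2) * u := by ring
      rw [this]
      refine mul_ne_zero ?_ (ne_of_gt hu.1)
      intro h0
      have h1 : (4 * (z₀ + z) + 2 : ℚ) = ((4 * (z₀ + z) + 2 : ℤ) : ℚ) := by push_cast; ring
      rw [h1] at h0
      have h2 : (4 * (z₀ + z) + 2 : ℤ) = 0 := by exact_mod_cast h0
      omega
    exact_mod_cast hq'
  intro hL0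
  rw [hL0, mul_zero] at hB
  have hΩ' : (minusPeriod f : ℂ) ≠ 0 := by exact_mod_cast (ne_of_gt hΩ)
  exact (mul_ne_zero (mul_ne_zero hS hΩ') Complex.I_ne_zero) hB

/-- **AN-33m: NON-VANISHING `L(W^{(d)}, 1) ≠ 0` at every pure-`3`-cycle door of an `η = 1` curve** (W-level reading of AN-33l
through the tree's signed Birch formula `ratMinusTwistedSymbolSum_jacobiChar_mul_minusPeriod` and the twist coefficients
`LFunction_quadraticTwist_apply_of_int_gcd_eq_one`; modularity enters as `hasEntireLFunction_rat` + `IsNewformOf W f`).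
For `W/ℚ` with newform `f`, a symbol unit `u` with `η_f = 1` (`F_{q₀} ∈ (2ℤ+1)u` at a `3`-cycle prime `q₀ ∤ N`), and a door
`d < 0`, `d ≡ 1 (mod 4)` square-free with `(d, N_W) = 1` all of whose prime factors `q` satisfy `q ∤ N`, `a_q(f)` odd:
`L(W^{(d)}, 1) ≠ 0`. -/
theorem entireLFunction_quadraticTwist_one_ne_zero_of_pureCycle (hE : hasEntireLFunction_rat)
    (W : WeierstrassCurve ℚ) [W.IsElliptic] (hfW : IsNewformOf W f) {u : ℚ} (hu : IsMinusSymbolUnit f u)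
    {q₀ : ℕ} {a₀ : ℤ} (hq₀ : q₀.Prime) (hq₀o : Odd q₀) (hq₀N : ¬ q₀ ∣ N) (ha₀ : cuspCoeff f q₀ = (a₀ : ℂ)) (ha₀o : Odd a₀)
    (hη : ∃ z₀ : ℤ, minusHalfSum f q₀ = (2 * z₀ + 1) * u)
    (a : ℕ → ℤ) {d : ℤ} (hd0 : d < 0) (hsq : Squarefree d) (hd4 : d % 4 = 1) (hgcd : Int.gcd d (W.conductorNorm ℤ) = 1)
    (hpr : ∀ q ∈ d.natAbs.primeFactors, ¬ q ∣ N ∧ cuspCoeff f q = (a q : ℂ)) (hpure : ∀ q ∈ d.natAbs.primeFactors, Odd (a q)) :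
    (W.quadraticTwist (d : ℚ)).entireLFunction 1 ≠ 0 := by
  set D : ℕ := d.natAbs with hDdef
  haveI : NeZero D := ⟨Int.natAbs_ne_zero.mpr hsq.ne_zero⟩
  have hDd : (D : ℤ) = -d := by rw [hDdef]; omega
  have hD3 : D % 4 = 3 := by omega
  have hDsq : Squarefree D := Int.squarefree_natAbs.mpr hsq
  have hDodd : Odd D := Nat.odd_iff.mpr (by omega)
  have hD1 : 1 < D := by omega
  have hdq : (d : ℚ) ≠ 0 := by exact_mod_cast hsq.ne_zero
  haveI := W.isElliptic_quadraticTwist hdq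
  have hEt : (W.quadraticTwist (d : ℚ)).HasEntireLFunction := hE _
  have hco : ∀ n : ℕ, (((W.quadraticTwist (d : ℚ)).LFunction n : ℤ) : ℂ) = jacobiChar D n * cuspCoeff f n := fun n ↦ by
    rw [LFunction_quadraticTwist_apply_of_int_gcd_eq_one W hd4 hsq hgcd n, Int.cast_mul, jacobiChar_natCast, hfW.2 n]
  have hL' : ∀ s : ℂ, 2 < s.re → (W.quadraticTwist (d : ℚ)).entireLFunction s = twistedLSeries f (jacobiChar D) s := by
    intro s hs
    rw [(W.quadraticTwist (d : ℚ)).entireLFunction_eq_LSeries hEt (by linarith)]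
    unfold WeierstrassCurve.LSeries twistedLSeries
    congr 1
    funext n
    exact hco n
  have hB := ratMinusTwistedSymbolSum_jacobiChar_mul_minusPeriod hfW.1 hfW.coeffField_eq_bot hDsq hD3
    ((W.quadraticTwist (d : ℚ)).differentiable_entireLFunction hEt) hL'
  -- the Jacobi character is odd and quadratic
  have hχo : (jacobiChar D).Odd := jacobiChar_neg_one_of_mod_four_eq_three hD3
  have hq : ∀ x : (ZMod D)ˣ, jacobiChar D x = 1 ∨ jacobiChar D x = -1 := by
    intro x
    rcases isQuadratic_jacobiChar (q := D) (x : ZMod D) with h0 | h1 | h2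
    · exact absurd ((Units.isUnit x).map (jacobiChar D)) (by rw [h0]; exact not_isUnit_zero)
    · exact Or.inl h1
    · exact Or.inr h2
  -- AN-33k at the pure level `D`
  obtain ⟨z, hz⟩ := (twistedMinusSymbolSumUnitClassLaw_holds N f hfW.1 hfW.coeffField_eq_bot u hu q₀ a₀ hq₀ hq₀o hq₀N
    ha₀ ha₀o a D hDsq hDodd hpr (jacobiChar D) hχo hq).1 ⟨hD1, hpure⟩
  obtain ⟨z₀, hz₀⟩ := hη
  have hS : ratMinusTwistedSymbolSum f (jacobiChar D) ≠ 0 := by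
    rw [hz, hz₀]
    have hq' : (2 : ℚ) * ((2 * z₀ + 1) * u) + 4 * z * u ≠ 0 := by
      have : (2 : ℚ) * ((2 * z₀ + 1) * u) + 4 * z * u = (4 * (z₀ + z) + 2) * u := by ring
      rw [this]
      refine mul_ne_zero ?_ (ne_of_gt hu.1)
      intro h0
      have h1 : (4 * (z₀ + z) + 2 : ℚ) = ((4 * (z₀ + z) + 2 : ℤ) : ℚ) := by push_cast; ring
      rw [h1] at h0
      have h2 : (4 * (z₀ + z) + 2 : ℤ) = 0 := by exact_mod_cast h0
      omega
    exact_mod_cast hq'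
  have hΩ' : (minusPeriod f : ℂ) ≠ 0 := by
    exact_mod_cast (ne_of_gt (IsNewform0.minusPeriod_pos_holds hfW.1 hfW.coeffField_eq_bot))
  intro hL0
  rw [hL0, mul_zero] at hB
  exact (mul_ne_zero hS hΩ') hB

end TwistedValue

end Summit.BirchSwinnertonDyer.Rank1Residual.F1Sign2.ANg16

end
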